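import Summits.Ventures.LatticeQCDFlow.Scaling.UnitSurvivalMoments

/-!
HONEST FRAMING: exact (Metropolis-corrected) sampling algorithms for lattice gauge theory; figures
of merit are autocorrelation/cost numbers at stated couplings and volumes; no continuum-physics
claim.

# UnitSurvivalRecursion — THE TWO-MOMENT RECURSION OF THE PLANTED-VALUE POTENTIAL `Φ = f + tg` ALONG THE IDEALISED
# HOT-ONLY STAR AT UNIFORM LISTING (`λ = t(1−t)c/m`): FOR EVERY PROBABILITY VECTOR `μ`,
# `(1−λ)·E_μΦ ≤ E_{μP}Φ ≤ (1−λ)·E_μΦ + λt·E_μ g + t(1−t)ν(s)`, `E_{μP} g ≤ (tc/m)·E_μΦ + (1−t)ν(s)`,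
# `E_{μP}Φ² ≤ (1−2λ)·E_μΦ² + (λ(1−t) + 2t(1−t)ν(s))·E_μΦ + (t(1−t) + 2λt² + 2λK)·E_μ g + t²(1−t)ν(s)` (lean-2 GEN-27, ours)

Venture-side (OURS).  Cell `lqcd-flow` (pub-lqcd), unit `pub-lqcd-lean-2-g27`, 2026-08-27.  Chapter M, the floor side,
file 6 (the `log K` programme, step 2 of 3).  Setting of `Scaling/UnitSurvivalMoments` (idealised hot-only star,
exact hot sampler, identity maps, uniform listing with multiplicity `c`, one law `ν`; `f` = cold copies of `s`,
`g` = hub indicator, `Φ = f + tg`).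

## What is proved

* §1 pointwise: `potentialSq_step_le` — the second-moment identity of `Scaling/UnitSurvivalMoments` bounded by
  `(1−2λ)Φ² + λ(1−t)f + (t(1−t) + 2λt² + 2λK)g + 2t(1−t)ν(s)f + t²(1−t)ν(s)` (uses `g ∈ {0,1}`, `0 ≤ f ≤ K`).
* §2 for a probability vector `μ` (means `E_μ = lawMean μ`): **`recursion_potential_ge`**, **`recursion_potential_le`**,
  **`recursion_hubInd_le`**, **`recursion_potentialSq_le`**, and `lawMean_coldCount_le_potential`,
  `lawMean_potential_le_coldCount_add`.
* §3 the planted start `x_s^u` (`s` at every cold level, `u ≠ s` at the hub): `planted_potential`, `planted_hubInd`,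
  `planted_potentialSq` (`Φ = K`, `g = 0`, `Φ² = K²`).

Reading (no numerics implied): the sequel solves the recursion and applies the second-moment method.  NOT CLAIMED
here: any floor.  Literature grade (cell rule): OWN COMPUTATION; nothing cited as a fact; no new bib keys.
-/

noncomputable section

open Finset Function
open Literature.Probability.MarkovChains

namespace Summit.Ventures.LatticeQCDFlow.Scaling

variable {S : Type*} [Fintype S] [DecidableEq S] {K m : ℕ} {ν : S → ℝ} {M : Fin (K + 1) → S → S → ℝ} {t : ℝ}

section Recursion
variable (κ : Fin m → Fin K)

/-! ## §1 The pointwise second-moment bound -/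

omit [Fintype S] [DecidableEq S] in
/-- **The second-moment expression is at most `(1−2λ)Φ² + λ(1−t)f + (t(1−t) + 2λt² + 2λK)g + 2t(1−t)ν_s f + t²(1−t)ν_s`**
for `g ∈ {0,1}`, `0 ≤ f ≤ K`, `0 ≤ t ≤ 1`, `λ ≥ 0` (`λ` written `t(1−t)(c/m)`). [ours] -/
theorem potentialSq_step_le {f g lam νs : ℝ} (hg : g = 0 ∨ g = 1) (hf0 : 0 ≤ f) (hfK : f ≤ K)
    (ht1 : t ≤ 1) (hlam : 0 ≤ lam) :
    t * ((f + g) ^ 2 - 2 * (1 - t) * (lam / (t * (1 - t))) * (f + g) * f + (1 - t) ^ 2 * (lam / (t * (1 - t))) * f)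
        + (1 - t) * (f ^ 2 + 2 * t * νs * f + t ^ 2 * νs)
      ≤ (1 - 2 * lam) * (f + t * g) ^ 2 + lam * (1 - t) * f + (t * (1 - t) + 2 * lam * t ^ 2 + 2 * lam * K) * g
        + 2 * t * (1 - t) * νs * f + t ^ 2 * (1 - t) * νs ∨ t * (1 - t) = 0 := by
  by_cases htt : t * (1 - t) = 0
  · exact Or.inr htt
  · left
    have key : lam / (t * (1 - t)) * (t * (1 - t)) = lam := div_mul_cancel₀ lam htt
    have e1 : t * (2 * (1 - t) * (lam / (t * (1 - t))) * (f + g) * f) = 2 * lam * (f + g) * f := by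
      calc t * (2 * (1 - t) * (lam / (t * (1 - t))) * (f + g) * f)
          = 2 * (f + g) * f * (lam / (t * (1 - t)) * (t * (1 - t))) := by ring
        _ = 2 * lam * (f + g) * f := by rw [key]; ring
    have e2 : t * ((1 - t) ^ 2 * (lam / (t * (1 - t))) * f) = lam * (1 - t) * f := by
      calc t * ((1 - t) ^ 2 * (lam / (t * (1 - t))) * f) = (1 - t) * f * (lam / (t * (1 - t)) * (t * (1 - t))) := by ring
        _ = lam * (1 - t) * f := by rw [key]; ring
    have e : t * ((f + g) ^ 2 - 2 * (1 - t) * (lam / (t * (1 - t))) * (f + g) * f + (1 - t) ^ 2 * (lam / (t * (1 - t))) * f)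
        = t * (f + g) ^ 2 - 2 * lam * (f + g) * f + lam * (1 - t) * f := by
      rw [mul_add, mul_sub, e1, e2]
    rw [e]
    rcases hg with hg0 | hg1
    · subst hg0; nlinarith
    · subst hg1
      have h1 : f * (2 * t - 1) ≤ K := by nlinarith
      nlinarith

/-! ## §2 The recursion for a probability vector -/

/-- `E_μ f ≤ E_μ Φ` (`μ ≥ 0`, `t ≥ 0`). [ours] -/
theorem lawMean_coldCount_le_potential (ht0 : 0 ≤ t) (s : S) {f : (Fin (K + 1) → S) → ℝ}
    {g : (Fin (K + 1) → S) → ℝ} (hg : ∀ z, g z = if z 0 = s then (1 : ℝ) else 0)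
    {μ : (Fin (K + 1) → S) → ℝ} (hμ : ∀ z, 0 ≤ μ z) :
    lawMean μ f ≤ lawMean μ (fun z => f z + t * g z) := by
  unfold lawMean
  exact sum_le_sum fun z _ => mul_le_mul_of_nonneg_left (by have := (hubInd_mem s hg z).1; nlinarith) (hμ z)

omit [DecidableEq S] in
/-- `E_μ Φ = E_μ f + t·E_μ g`. [ours] -/
theorem lawMean_potential_eq {f : (Fin (K + 1) → S) → ℝ} {g : (Fin (K + 1) → S) → ℝ}
    (μ : (Fin (K + 1) → S) → ℝ) :
    lawMean μ (fun z => f z + t * g z) = lawMean μ f + t * lawMean μ g := by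
  unfold lawMean
  rw [Finset.mul_sum, ← Finset.sum_add_distrib]
  exact sum_congr rfl fun z _ => by ring

/-- **`E_{μP}Φ ≥ (1−λ)·E_μΦ`** (`μ ≥ 0`). [ours] -/
theorem recursion_potential_ge (hm : 1 ≤ m) (ht0 : 0 ≤ t) (ht1 : t ≤ 1) (hν : ∀ v, 0 < ν v) (hν1 : ∑ v, ν v = 1)
    (hM0 : ∀ u v, M 0 u v = ν v) {c : ℕ} (hcu : ∀ p' : Fin K, (univ.filter (fun r : Fin m => κ r = p')).card = c)
    (s : S) {f : (Fin (K + 1) → S) → ℝ} (hf : ∀ z, f z = ∑ k : Fin K, (if z k.succ = s then (1 : ℝ) else 0))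
    {g : (Fin (K + 1) → S) → ℝ} (hg : ∀ z, g z = if z 0 = s then (1 : ℝ) else 0)
    {μ : (Fin (K + 1) → S) → ℝ} (hμ : ∀ z, 0 ≤ μ z) :
    (1 - t * (1 - t) * c / m) * lawMean μ (fun z => f z + t * g z)
      ≤ lawMean (stepLaw (fun y z : Fin (K + 1) → S => t * ptGraphSwap (fun _ : Fin (K + 1) => ν)
          (fun r : Fin m => (((0 : Fin (K + 1)), (κ r).succ) : Fin (K + 1) × Fin (K + 1))) (fun _ => Equiv.refl S) y z
        + (1 - t) * prodKernel (fun k : Fin (K + 1) => if k = 0 then (1 : ℝ) else 0) M y z) μ) (fun z => f z + t * g z) := by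
  rw [lawMean_stepLaw]
  simp_rw [ideal_step_potential κ hm hν hν1 hM0 hcu s hf hg]
  have hmpos : (0 : ℝ) < m := Nat.cast_pos.mpr (by omega)
  have hlam : 0 ≤ t * (1 - t) * c / m := by
    have : 0 ≤ 1 - t := by linarith
    positivity
  unfold lawMean
  rw [Finset.mul_sum]
  refine sum_le_sum fun z _ => ?_
  have hfz := (coldCount_mem s hf z).1
  have hgz := (hubInd_mem s hg z).1
  have hνs := (hν s).le
  have hfΦ : f z ≤ f z + t * g z := by nlinarith
  have h3 : 0 ≤ t * (1 - t) * c / m * (t * g z) := mul_nonneg hlam (mul_nonneg ht0 hgz)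
  have h4 : 0 ≤ t * (1 - t) * ν s := mul_nonneg (mul_nonneg ht0 (by linarith)) hνs
  have : (1 - t * (1 - t) * c / m) * (f z + t * g z) ≤ (f z + t * g z) - t * (1 - t) * c / m * f z + t * (1 - t) * ν s := by
    nlinarith [h3, h4]
  calc (1 - t * (1 - t) * c / m) * (μ z * (f z + t * g z)) = μ z * ((1 - t * (1 - t) * c / m) * (f z + t * g z)) := by ring
    _ ≤ μ z * ((f z + t * g z) - t * (1 - t) * c / m * f z + t * (1 - t) * ν s) := mul_le_mul_of_nonneg_left this (hμ z)

/-- **`E_{μP}Φ = E_μΦ − λ·E_μ f + t(1−t)ν(s)`** (`Σμ = 1`). [ours] -/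
theorem recursion_potential_eq (hm : 1 ≤ m) (hν : ∀ v, 0 < ν v) (hν1 : ∑ v, ν v = 1)
    (hM0 : ∀ u v, M 0 u v = ν v) {c : ℕ} (hcu : ∀ p' : Fin K, (univ.filter (fun r : Fin m => κ r = p')).card = c)
    (s : S) {f : (Fin (K + 1) → S) → ℝ} (hf : ∀ z, f z = ∑ k : Fin K, (if z k.succ = s then (1 : ℝ) else 0))
    {g : (Fin (K + 1) → S) → ℝ} (hg : ∀ z, g z = if z 0 = s then (1 : ℝ) else 0)
    {μ : (Fin (K + 1) → S) → ℝ} (hμ1 : ∑ z, μ z = 1) :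
    lawMean (stepLaw (fun y z : Fin (K + 1) → S => t * ptGraphSwap (fun _ : Fin (K + 1) => ν)
          (fun r : Fin m => (((0 : Fin (K + 1)), (κ r).succ) : Fin (K + 1) × Fin (K + 1))) (fun _ => Equiv.refl S) y z
        + (1 - t) * prodKernel (fun k : Fin (K + 1) => if k = 0 then (1 : ℝ) else 0) M y z) μ) (fun z => f z + t * g z)
      = lawMean μ (fun z => f z + t * g z) - t * (1 - t) * c / m * lawMean μ f + t * (1 - t) * ν s := by
  rw [lawMean_stepLaw]
  simp_rw [ideal_step_potential κ hm hν hν1 hM0 hcu s hf hg]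
  unfold lawMean
  rw [Finset.mul_sum, ← Finset.sum_sub_distrib]
  have e : ∀ z, μ z * (f z + t * g z - t * (1 - t) * c / m * f z + t * (1 - t) * ν s)
      = (μ z * (f z + t * g z) - t * (1 - t) * c / m * (μ z * f z)) + μ z * (t * (1 - t) * ν s) := fun z => by ring
  simp_rw [e]
  rw [Finset.sum_add_distrib, ← Finset.sum_mul, hμ1, one_mul]

/-- **`E_{μP} g = (tc/m)·E_μ f + (1−t)ν(s)`** (`Σμ = 1`). [ours] -/
theorem recursion_hubInd_eq (hm : 1 ≤ m) (hν : ∀ v, 0 < ν v) (hM0 : ∀ u v, M 0 u v = ν v)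
    {c : ℕ} (hcu : ∀ p' : Fin K, (univ.filter (fun r : Fin m => κ r = p')).card = c)
    (s : S) {f : (Fin (K + 1) → S) → ℝ} (hf : ∀ z, f z = ∑ k : Fin K, (if z k.succ = s then (1 : ℝ) else 0))
    {g : (Fin (K + 1) → S) → ℝ} (hg : ∀ z, g z = if z 0 = s then (1 : ℝ) else 0)
    {μ : (Fin (K + 1) → S) → ℝ} (hμ1 : ∑ z, μ z = 1) :
    lawMean (stepLaw (fun y z : Fin (K + 1) → S => t * ptGraphSwap (fun _ : Fin (K + 1) => ν)
          (fun r : Fin m => (((0 : Fin (K + 1)), (κ r).succ) : Fin (K + 1) × Fin (K + 1))) (fun _ => Equiv.refl S) y z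
        + (1 - t) * prodKernel (fun k : Fin (K + 1) => if k = 0 then (1 : ℝ) else 0) M y z) μ) g
      = t * c / m * lawMean μ f + (1 - t) * ν s := by
  rw [lawMean_stepLaw]
  simp_rw [ideal_step_hubInd κ hm hν hM0 hcu s hf hg]
  unfold lawMean
  rw [Finset.mul_sum]
  have e : ∀ z, μ z * (t * c / m * f z + (1 - t) * ν s) = t * c / m * (μ z * f z) + μ z * ((1 - t) * ν s) :=
    fun z => by ring
  simp_rw [e]
  rw [Finset.sum_add_distrib, ← Finset.sum_mul, hμ1, one_mul]

/-- **THE SECOND-MOMENT STEP: `E_{μP}Φ² ≤ (1−2λ)·E_μΦ² + (λ(1−t) + 2t(1−t)ν(s))·E_μ f + (t(1−t) + 2λt² + 2λK)·E_μ g + t²(1−t)ν(s)`**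
(`μ ≥ 0`, `Σμ = 1`, `0 < t < 1`, `λ = t(1−t)c/m`). [ours] -/
theorem recursion_potentialSq_le (hm : 1 ≤ m) (ht0 : 0 < t) (ht1 : t < 1) (hν : ∀ v, 0 < ν v) (hν1 : ∑ v, ν v = 1)
    (hM0 : ∀ u v, M 0 u v = ν v) {c : ℕ} (hcu : ∀ p' : Fin K, (univ.filter (fun r : Fin m => κ r = p')).card = c)
    (s : S) {f : (Fin (K + 1) → S) → ℝ} (hf : ∀ z, f z = ∑ k : Fin K, (if z k.succ = s then (1 : ℝ) else 0))
    {g : (Fin (K + 1) → S) → ℝ} (hg : ∀ z, g z = if z 0 = s then (1 : ℝ) else 0)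
    {μ : (Fin (K + 1) → S) → ℝ} (hμ : ∀ z, 0 ≤ μ z) (hμ1 : ∑ z, μ z = 1) :
    lawMean (stepLaw (fun y z : Fin (K + 1) → S => t * ptGraphSwap (fun _ : Fin (K + 1) => ν)
          (fun r : Fin m => (((0 : Fin (K + 1)), (κ r).succ) : Fin (K + 1) × Fin (K + 1))) (fun _ => Equiv.refl S) y z
        + (1 - t) * prodKernel (fun k : Fin (K + 1) => if k = 0 then (1 : ℝ) else 0) M y z) μ)
        (fun z => (f z + t * g z) ^ 2)
      ≤ (1 - 2 * (t * (1 - t) * c / m)) * lawMean μ (fun z => (f z + t * g z) ^ 2)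
        + (t * (1 - t) * c / m * (1 - t) + 2 * t * (1 - t) * ν s) * lawMean μ f
        + (t * (1 - t) + 2 * (t * (1 - t) * c / m) * t ^ 2 + 2 * (t * (1 - t) * c / m) * K) * lawMean μ g
        + t ^ 2 * (1 - t) * ν s := by
  rw [lawMean_stepLaw]
  simp_rw [ideal_step_potentialSq κ hm hν hν1 hM0 hcu s hf hg]
  have hmpos : (0 : ℝ) < m := Nat.cast_pos.mpr (by omega)
  have htt : t * (1 - t) ≠ 0 := (mul_pos ht0 (by linarith)).ne'
  have hlam : 0 ≤ t * (1 - t) * c / m := by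
    have : 0 ≤ 1 - t := by linarith
    positivity
  have hcm : (c : ℝ) / m = (t * (1 - t) * c / m) / (t * (1 - t)) := by rw [eq_div_iff htt]; ring
  -- pointwise bound, then integrate against `μ`
  have hpt : ∀ z, t * ((f z + g z) ^ 2 - 2 * (1 - t) * (c / m) * (f z + g z) * f z + (1 - t) ^ 2 * (c / m) * f z)
        + (1 - t) * (f z ^ 2 + 2 * t * ν s * f z + t ^ 2 * ν s)
      ≤ (1 - 2 * (t * (1 - t) * c / m)) * (f z + t * g z) ^ 2 + (t * (1 - t) * c / m) * (1 - t) * f z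
        + (t * (1 - t) + 2 * (t * (1 - t) * c / m) * t ^ 2 + 2 * (t * (1 - t) * c / m) * K) * g z
        + 2 * t * (1 - t) * ν s * f z + t ^ 2 * (1 - t) * ν s := by
    intro z
    have hgz : g z = 0 ∨ g z = 1 := by rw [hg]; split_ifs <;> simp
    obtain ⟨hf0, hfK⟩ := coldCount_mem s hf z
    rw [hcm]
    rcases potentialSq_step_le (K := K) (f := f z) (g := g z) (lam := t * (1 - t) * c / m) (νs := ν s) hgz hf0 hfK
      ht1.le hlam with h | h
    · exact h
    · exact absurd h htt
  unfold lawMean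
  calc ∑ z, μ z * (t * ((f z + g z) ^ 2 - 2 * (1 - t) * (c / m) * (f z + g z) * f z + (1 - t) ^ 2 * (c / m) * f z)
        + (1 - t) * (f z ^ 2 + 2 * t * ν s * f z + t ^ 2 * ν s))
      ≤ ∑ z, μ z * ((1 - 2 * (t * (1 - t) * c / m)) * (f z + t * g z) ^ 2 + (t * (1 - t) * c / m) * (1 - t) * f z
        + (t * (1 - t) + 2 * (t * (1 - t) * c / m) * t ^ 2 + 2 * (t * (1 - t) * c / m) * K) * g z
        + 2 * t * (1 - t) * ν s * f z + t ^ 2 * (1 - t) * ν s) :=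
        sum_le_sum fun z _ => mul_le_mul_of_nonneg_left (hpt z) (hμ z)
    _ = _ := by
        have e : ∀ z, μ z * ((1 - 2 * (t * (1 - t) * c / m)) * (f z + t * g z) ^ 2 + (t * (1 - t) * c / m) * (1 - t) * f z
            + (t * (1 - t) + 2 * (t * (1 - t) * c / m) * t ^ 2 + 2 * (t * (1 - t) * c / m) * K) * g z
            + 2 * t * (1 - t) * ν s * f z + t ^ 2 * (1 - t) * ν s)
          = (1 - 2 * (t * (1 - t) * c / m)) * (μ z * (f z + t * g z) ^ 2)
            + (t * (1 - t) * c / m * (1 - t) + 2 * t * (1 - t) * ν s) * (μ z * f z)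
            + (t * (1 - t) + 2 * (t * (1 - t) * c / m) * t ^ 2 + 2 * (t * (1 - t) * c / m) * K) * (μ z * g z)
            + μ z * (t ^ 2 * (1 - t) * ν s) := fun z => by ring
        simp_rw [e]
        rw [Finset.sum_add_distrib, Finset.sum_add_distrib, Finset.sum_add_distrib, ← Finset.mul_sum, ← Finset.mul_sum,
          ← Finset.mul_sum, ← Finset.sum_mul, hμ1, one_mul]

/-! ## §3 The planted start -/

omit [Fintype S] in
/-- **The planted start `x_s^u` (`x_0 = u ≠ s`, `x_{k+1} = s`) has `f = K`, `g = 0`.** [ours] -/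
theorem planted_values (s u : S) (hus : u ≠ s) {f : (Fin (K + 1) → S) → ℝ}
    (hf : ∀ z, f z = ∑ k : Fin K, (if z k.succ = s then (1 : ℝ) else 0))
    {g : (Fin (K + 1) → S) → ℝ} (hg : ∀ z, g z = if z 0 = s then (1 : ℝ) else 0) :
    f (Fin.cons u (fun _ : Fin K => s) : Fin (K + 1) → S) = K ∧ g (Fin.cons u (fun _ : Fin K => s) : Fin (K + 1) → S) = 0 := by
  constructor
  · rw [hf]
    simp only [Fin.cons_succ, if_true, sum_const, card_univ, Fintype.card_fin, nsmul_eq_mul, mul_one]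
  · rw [hg, Fin.cons_zero, if_neg hus]

end Recursion

end Summit.Ventures.LatticeQCDFlow.Scaling

end
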